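import Summits.ValiantsHypothesis.ValiantsHypothesis.Theorems.BarrierLeverChowBenchmarkPairsKernelPeel
import Summits.ValiantsHypothesis.ValiantsHypothesis.Theorems.BarrierLeverChowBenchmarkPairsZetaMinors

/-!
# Route BarrierLever — item 22038 `ChowBenchmarkPairs`, line `moore-peel`: THEOREM M — MIDPOINT (SUMSET)
# POISEDNESS AT EVERY HEIGHT (`Stmt.midpointPoised`), by the unit-weight hierarchical Moore peel and LEMMA Z′

Helper file (`--supports stmt-ValiantsHypothesis-22038`; cell valiant-natproofs, rung V4, 𝒟-side benchmark of
record, line `moore_peel`, card v12 (E)(ii) / reading of record R24; seat val-np-p4 gen 26, kernel form of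
THEOREM M of the seat's memo `HOME/val-np-p4/g25/MEMO-valnp4-g25.md` §4bis).  Closes NO item.  Two statement
definitions (`MidpointPoisedAt h`, `Stmt.midpointPoised`), both PROVED here.

THEOREM M (`midpointPoisedAt`, `midpointPoised : Stmt.midpointPoised`).  For EVERY `h`: for every injective
enumeration `u` of the subsets of `Fin h` of size `≤ 2` and the first `r` binary codes `T_j = benchCols h r j`
(so `r = c_{h+1} = 1 + h + C(h,2)`), some point table `P : Fin h → Fin h → ℂ` makes the evaluation matrix
`[∏_{c ∈ T_j} Σ_{a ∈ u i} P_{a,c}]_{i,j}` — the monomials `z^{T_j}` at the SUMSET points `0`, `P_a`, `P_a + P_b`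
(origin, points, twice the midpoints) — nonsingular.  This is the `exp`-kernel twin of the line's open stub
`stub_segmentMeanValue = ∀ h, SegmentMeanValueAt h` (segment means = kernel `1/(1-x)`): same rows, same columns,
same points, weights `κ = 1` instead of `κ = k!` (`prod_sum_eq_sum_functions`: the entry is `segEntry` without
its factorials).  It is the line's first ∀h POSITIVE poisedness theorem for a full `c_{h+1}`-configuration family.

PROOF.  THEOREM A^κ of `…KernelPeel` with `κ = 1`: the unit-weight stage matrices are the zeta windows
`Z_i = zetaPeelMatrix i` (`kpeelMatrix_one`), unimodular for EVERY `i` by LEMMA Z′ (`…ZetaMinors`,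
`det_zetaPeelMatrix_ne_zero`), so the stage-1 unit-weight rows with symbolic Moore nodes are linearly independent
for every `h` (`linearIndependent_krow_one_stageOne`); the rows of size `≤ 2` of the symbolic evaluation matrix ARE
these rows (`eval_empty_eq_krow`, `eval_singleton_eq_krow`, `eval_pair_eq_krow` — binomial expansion
`∏_{c∈T}(x_c + y_c) = Σ_{d⊆T} x^{T∖d} y^d`), so its determinant is a nonzero polynomial in the nodes and has a
complex non-root (`midpointPoisedAt_of_linearIndependent`).

READING (R24).  The ∀h obstruction of the segment-mean benchmark is therefore located exactly in the factorial
kernel (`det G_183 = 0`, `…MooreBenchStop`), not in the binary-window combinatorics, which THEOREM M settles ∀h.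

WHAT THIS IS NOT: no stub of line `moore_peel` is closed; nothing is claimed about the segment-mean benchmark
`stub_segmentMeanValue` (factorial weights, `det G_183 = 0`); nothing on crux stmt-ValiantsHypothesis-14610 or on
`VP` versus `VNP`.
-/

set_option linter.dupNamespace false

namespace Summit.ValiantsHypothesis.ValiantsHypothesis.Theorems.BarrierLever.MoorePeel

open Polynomial Finset
/-! ## 6. Unit weights: the stage matrices are the zeta windows, so THEOREM A^1 is unconditional -/

/-- With unit weights the kernel entries are the Boolean inclusion entries. -/
theorem kincl_one (j c : ℕ) : kincl (fun _ => 1) j c = if bits j ⊆ bits c then 1 else 0 := rfl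

/-- With unit weights the stage matrices are the zeta windows `Z_i = zetaPeelMatrix i` (LEMMA Z′ file). -/
theorem kpeelMatrix_one (i : ℕ) : kpeelMatrix (fun _ => 1) i = zetaPeelMatrix i := by
  ext j m
  rw [kpeelMatrix_eq_kincl, zetaPeelMatrix_apply, kincl_one]
  split_ifs <;> simp

/-- LEMMA Z′ ⇒ every unit-weight stage matrix is nonsingular. -/
theorem det_kpeelMatrix_one_ne_zero (i : ℕ) : (kpeelMatrix (fun _ => 1) i).det ≠ 0 := by
  rw [kpeelMatrix_one]
  exact det_zetaPeelMatrix_ne_zero i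

/-- **THEOREM A^1, unconditionally** (LEMMA Z′): for every `h` the unit-weight stage-1 rows are
linearly independent over `MvPolynomial (Fin h) ℂ`. -/
theorem linearIndependent_krow_one_stageOne (h : ℕ) :
    LinearIndependent (MvPolynomial (Fin h) ℂ)
      (fun x : ↥(stageRows 1 h) =>
        krow (fun _ => 1) (windowStart (h + 1)) (nodeY h) (x : RowLabel)) :=
  linearIndependent_krow_stageOne (fun _ => 1) (fun _ => Nat.one_ne_zero) h
    fun i _ _ => det_kpeelMatrix_one_ne_zero i

/-! ## 7. THEOREM M: midpoint (sumset) poisedness at every height -/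

/-- **Midpoint (sumset) poisedness at height `h`** — the `exp`-kernel twin of the line file's
`SegmentMeanValueAt h`: for every injective enumeration `u` of the subsets of `Fin h` of size `≤ 2`
(rows) and the first `r` binary codes (columns), some point table `P : Fin h → Fin h → ℂ` makes the
EVALUATION matrix `[z^{T_j}(Σ_{a ∈ u i} P_a)] = [∏_{c ∈ T_j} Σ_{a ∈ u i} P_{a,c}]` nonsingular — the
monomials `z^T`, `T` a benchmark column, evaluated at the SUMSET points `0`, `P_a`, `P_a + P_b`
(the origin, the points and twice the midpoints).  (`segEntry P S T` of the line file without its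
factorial weights is `Σ_{g : T → S} ∏_{c∈T} P_{g c, c} = ∏_{c∈T} Σ_{a∈S} P_{a,c}`.) -/
def MidpointPoisedAt (h : ℕ) : Prop :=
  ∀ (r : ℕ) (u : Fin r → Finset (Fin h)), Function.Injective u → (∀ i, (u i).card ≤ 2) →
    (∀ S : Finset (Fin h), S.card ≤ 2 → ∃ i, u i = S) →
    ∃ P : Fin h → Fin h → ℂ,
      (Matrix.of fun i j : Fin r => ∏ c ∈ benchCols h r j, ∑ a ∈ u i, P a c).det ≠ 0

/-- **THEOREM M as a typed statement of line `moore_peel`**: midpoint poisedness at EVERY height. -/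
def Stmt.midpointPoised : Prop := ∀ h : ℕ, MidpointPoisedAt h

section Midpoint

variable {h : ℕ}

/-- The benchmark column `j` is empty iff `j = 0`. -/
theorem benchCols_eq_empty_iff {r : ℕ} (j : Fin r) (hj : (j : ℕ) < 2 ^ h) :
    benchCols h r j = ∅ ↔ (j : ℕ) = 0 := by
  constructor
  · intro e
    have := map_benchCols j hj
    rw [e, Finset.map_empty] at this
    exact bits_injective (by rw [← this, bits_zero])
  · intro e
    apply Finset.map_injective Fin.valEmbedding
    rw [map_benchCols j hj, e, bits_zero, Finset.map_empty]

/-- Row `∅`: the evaluation row of the origin is the monomial row `e_0`. -/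
theorem eval_empty_eq_krow {r : ℕ} (hr : r ≤ 2 ^ h) (j : Fin r) :
    ∏ c ∈ benchCols h r j, ∑ a ∈ (∅ : Finset (Fin h)), ((MvPolynomial.X a : MvPolynomial (Fin h) ℂ) ^ 2 ^ (c : ℕ)) =
      krow (fun _ => 1) r (nodeY h) (Sum.inl 0) j := by
  have hj : (j : ℕ) < 2 ^ h := lt_of_lt_of_le j.2 hr
  simp only [Finset.sum_empty, Finset.prod_const, krow]
  by_cases h0 : (j : ℕ) = 0
  · rw [if_pos h0, (benchCols_eq_empty_iff j hj).mpr h0, Finset.card_empty, pow_zero]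
  · rw [if_neg h0, zero_pow]
    exact Finset.card_ne_zero.mpr (Finset.nonempty_iff_ne_empty.mpr
      fun e => h0 ((benchCols_eq_empty_iff j hj).mp e))

/-- Row `{b}`: the evaluation row of the Moore point `P_b = (Y_b^(2^c))_c` is the attached row `(T_0, {b})`. -/
theorem eval_singleton_eq_krow {r : ℕ} (hr : r ≤ 2 ^ h) (b : Fin h) (j : Fin r) :
    ∏ c ∈ benchCols h r j, ∑ a ∈ ({b} : Finset (Fin h)), ((MvPolynomial.X a : MvPolynomial (Fin h) ℂ) ^ 2 ^ (c : ℕ)) =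
      krow (fun _ => 1) r (nodeY h) (Sum.inr (Sum.inl (0, (b : ℕ)))) j := by
  have hj : (j : ℕ) < 2 ^ h := lt_of_lt_of_le j.2 hr
  simp only [Finset.sum_singleton, krow, bits_zero, Finset.empty_subset, if_true, Finset.sdiff_empty,
    Nat.cast_one, one_mul]
  rw [prod_nodeY_pow, map_benchCols j hj]

/-- Row `{b, b'}` (`b ≠ b'`): the evaluation row of the sum `P_b + P_{b'}` of two Moore points is the
pair row `(∅, {b, b'})` (binomial expansion `∏_{c∈T}(x_c + y_c) = Σ_{d ⊆ T} x^{T∖d} y^d`). -/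
theorem eval_pair_eq_krow {r : ℕ} (hr : r ≤ 2 ^ h) (b b' : Fin h) (hbb : b ≠ b') (j : Fin r) :
    ∏ c ∈ benchCols h r j, ∑ a ∈ ({b, b'} : Finset (Fin h)),
        ((MvPolynomial.X a : MvPolynomial (Fin h) ℂ) ^ 2 ^ (c : ℕ)) =
      krow (fun _ => 1) r (nodeY h) (Sum.inr (Sum.inr ((b : ℕ), (b' : ℕ)))) j := by
  classical
  have hj : (j : ℕ) < 2 ^ h := lt_of_lt_of_le j.2 hr
  simp only [Finset.sum_pair hbb, krow, Nat.cast_one, one_mul]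
  set T := benchCols h r j with hT
  have e1 : ∏ c ∈ T, ((MvPolynomial.X b : MvPolynomial (Fin h) ℂ) ^ 2 ^ (c : ℕ) + (MvPolynomial.X b' : MvPolynomial (Fin h) ℂ) ^ 2 ^ (c : ℕ)) =
      ∑ d ∈ T.powerset, (∏ c ∈ T \ d, (MvPolynomial.X b : MvPolynomial (Fin h) ℂ) ^ 2 ^ (c : ℕ)) *
        ∏ c ∈ d, (MvPolynomial.X b' : MvPolynomial (Fin h) ℂ) ^ 2 ^ (c : ℕ) := by
    have e0 : ∏ c ∈ T, ((MvPolynomial.X b : MvPolynomial (Fin h) ℂ) ^ 2 ^ (c : ℕ) +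
        (MvPolynomial.X b' : MvPolynomial (Fin h) ℂ) ^ 2 ^ (c : ℕ)) =
        ∏ c ∈ T, ((MvPolynomial.X b' : MvPolynomial (Fin h) ℂ) ^ 2 ^ (c : ℕ) +
          (MvPolynomial.X b : MvPolynomial (Fin h) ℂ) ^ 2 ^ (c : ℕ)) :=
      Finset.prod_congr rfl fun c _ => add_comm _ _
    rw [e0, Finset.prod_add]
    exact Finset.sum_congr rfl fun d _ => mul_comm _ _
  rw [e1]
  have hbitsT : bits (j : ℕ) = T.map Fin.valEmbedding := (map_benchCols j hj).symm
  rw [hbitsT]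
  have himage : (T.map Fin.valEmbedding).powerset =
      T.powerset.image fun d => d.map Fin.valEmbedding := by
    rw [Finset.map_eq_image, Finset.powerset_image]
    congr 1
    funext d
    rw [Finset.map_eq_image]
  rw [himage, Finset.sum_image (fun d _ d' _ e => Finset.map_injective _ e)]
  refine Finset.sum_congr rfl fun d _ => ?_
  rw [← Finset.map_sdiff, prod_nodeY_pow, prod_nodeY_pow]

/-- **Reduction.**  If the unit-weight stage-1 rows with symbolic Moore nodes are linearly independent,
then `MidpointPoisedAt h` (rows of size `≤ 2` of the symbolic evaluation matrix ARE these rows; a nonzero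
polynomial determinant has a complex non-root). -/
theorem midpointPoisedAt_of_linearIndependent (h : ℕ)
    (hLI : LinearIndependent (MvPolynomial (Fin h) ℂ)
      (fun x : ↥(stageRows 1 h) =>
        krow (fun _ => 1) (windowStart (h + 1)) (nodeY h) (x : RowLabel))) :
    MidpointPoisedAt h := by
  classical
  intro r u hu hcard hsurj
  -- (i) `r = c_{h+1}`
  have hr : r = windowStart (h + 1) := by
    have himg : Finset.univ.image u =
        (Finset.univ : Finset (Finset (Fin h))).filter fun S => S.card ≤ 2 := by
      ext S
      simp only [Finset.mem_image, Finset.mem_univ, true_and, Finset.mem_filter]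
      constructor
      · rintro ⟨i, rfl⟩
        exact hcard i
      · intro hS
        obtain ⟨i, hi⟩ := hsurj S hS
        exact ⟨i, hi⟩
    have := congrArg Finset.card himg
    rwa [Finset.card_image_of_injective _ hu, Finset.card_univ, Fintype.card_fin,
      card_filter_card_le_two] at this
  subst hr
  have hr2 : windowStart (h + 1) ≤ 2 ^ h := windowStart_succ_le_two_pow h
  -- (ii) labels of the rows
  obtain ⟨lab, lab_empty, lab_single, lab_pair⟩ : ∃ lab : Finset (Fin h) → RowLabel,
      lab ∅ = Sum.inl 0 ∧ (∀ b : Fin h, lab {b} = Sum.inr (Sum.inl (0, (b : ℕ)))) ∧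
      (∀ b b' : Fin h, b < b' → lab {b, b'} = Sum.inr (Sum.inr ((b : ℕ), (b' : ℕ)))) := by
    refine ⟨fun S => if hS : S.Nonempty then
      (if S.card = 1 then Sum.inr (Sum.inl (0, ((S.min' hS : Fin h) : ℕ)))
       else Sum.inr (Sum.inr (((S.min' hS : Fin h) : ℕ), ((S.max' hS : Fin h) : ℕ))))
      else Sum.inl 0, by simp, fun b => by simp, fun b b' hlt => ?_⟩
    have hne : ({b, b'} : Finset (Fin h)).Nonempty := ⟨b, by simp⟩
    have hc : ({b, b'} : Finset (Fin h)).card ≠ 1 := by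
      rw [Finset.card_pair (ne_of_lt hlt)]
      norm_num
    have hmin : ({b, b'} : Finset (Fin h)).min' hne = b :=
      le_antisymm (Finset.min'_le _ _ (by simp))
        (Finset.le_min' _ _ _ fun y hy => by
          rcases Finset.mem_insert.mp hy with rfl | hy
          · exact le_rfl
          · rw [Finset.mem_singleton.mp hy]; exact le_of_lt hlt)
    have hmax : ({b, b'} : Finset (Fin h)).max' hne = b' :=
      le_antisymm
        (Finset.max'_le _ _ _ fun y hy => by
          rcases Finset.mem_insert.mp hy with rfl | hy
          · exact le_of_lt hlt
          · rw [Finset.mem_singleton.mp hy])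
        (Finset.le_max' _ _ (by simp))
    simp only [hne, dif_pos, hc, if_false, hmin, hmax]
  -- (iii) the row identity: symbolic evaluation rows ARE the unit-weight stage-1 rows
  have hrow : ∀ i j, ∏ c ∈ benchCols h (windowStart (h + 1)) j, ∑ a ∈ u i,
      ((MvPolynomial.X a : MvPolynomial (Fin h) ℂ) ^ 2 ^ (c : ℕ)) =
      krow (fun _ => 1) (windowStart (h + 1)) (nodeY h) (lab (u i)) j := by
    intro i j
    rcases eq_empty_or_singleton_or_pair (u i) (hcard i) with h0 | ⟨b, hb⟩ | ⟨b, b', hlt, hbb⟩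
    · rw [h0, lab_empty]
      exact eval_empty_eq_krow hr2 j
    · rw [hb, lab_single]
      exact eval_singleton_eq_krow hr2 b j
    · rw [hbb, lab_pair b b' hlt]
      exact eval_pair_eq_krow hr2 b b' (ne_of_lt hlt) j
  -- (iv) the labels are alive at stage 1 and pairwise distinct
  have hmem : ∀ i, lab (u i) ∈ stageRows 1 h := by
    intro i
    rcases eq_empty_or_singleton_or_pair (u i) (hcard i) with h0 | ⟨b, hb⟩ | ⟨b, b', hlt, hbb⟩
    · rw [h0, lab_empty, inl_mem_stageRows, windowStart_one]
      exact Nat.one_pos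
    · rw [hb, lab_single, inr_inl_mem_stageRows]
      exact ⟨Nat.one_pos, b.2⟩
    · rw [hbb, lab_pair b b' hlt, inr_inr_mem_stageRows]
      exact ⟨hlt, b'.2⟩
  have hinj : Function.Injective fun i => (⟨lab (u i), hmem i⟩ : ↥(stageRows 1 h)) := by
    intro i i' e
    have e' : lab (u i) = lab (u i') := congrArg Subtype.val e
    apply hu
    rcases eq_empty_or_singleton_or_pair (u i) (hcard i) with h0 | ⟨b, hb⟩ | ⟨b, b', hlt, hbb⟩ <;>
      rcases eq_empty_or_singleton_or_pair (u i') (hcard i') with h0' | ⟨c, hc⟩ | ⟨c, c', hlt', hcc⟩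
    · rw [h0, h0']
    · rw [h0, lab_empty, hc, lab_single] at e'
      exact absurd e' (by simp)
    · rw [h0, lab_empty, hcc, lab_pair c c' hlt'] at e'
      exact absurd e' (by simp)
    · rw [hb, lab_single, h0', lab_empty] at e'
      exact absurd e' (by simp)
    · rw [hb, lab_single, hc, lab_single] at e'
      rw [hb, hc]
      simp only [Sum.inr.injEq, Sum.inl.injEq, Prod.mk.injEq, true_and] at e'
      rw [Fin.ext e']
    · rw [hb, lab_single, hcc, lab_pair c c' hlt'] at e'
      exact absurd e' (by simp)
    · rw [hbb, lab_pair b b' hlt, h0', lab_empty] at e'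
      exact absurd e' (by simp)
    · rw [hbb, lab_pair b b' hlt, hc, lab_single] at e'
      exact absurd e' (by simp)
    · rw [hbb, lab_pair b b' hlt, hcc, lab_pair c c' hlt'] at e'
      rw [hbb, hcc]
      simp only [Sum.inr.injEq, Prod.mk.injEq] at e'
      rw [Fin.ext e'.1, Fin.ext e'.2]
  -- (v) the symbolic evaluation matrix has independent rows, hence nonzero determinant
  have hLI' : LinearIndependent (MvPolynomial (Fin h) ℂ)
      (fun i => krow (fun _ => 1) (windowStart (h + 1)) (nodeY h) (lab (u i))) :=
    hLI.comp (fun i => (⟨lab (u i), hmem i⟩ : ↥(stageRows 1 h))) hinj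
  set B : Matrix (Fin (windowStart (h + 1))) (Fin (windowStart (h + 1))) (MvPolynomial (Fin h) ℂ) :=
    Matrix.of fun i j => ∏ c ∈ benchCols h (windowStart (h + 1)) j, ∑ a ∈ u i,
      ((MvPolynomial.X a : MvPolynomial (Fin h) ℂ) ^ 2 ^ (c : ℕ)) with hB
  have hBrows : LinearIndependent (MvPolynomial (Fin h) ℂ) (fun i => B i) := by
    have e : (fun i => B i) = fun i => krow (fun _ => 1) (windowStart (h + 1)) (nodeY h) (lab (u i)) := by
      funext i j
      rw [hB, Matrix.of_apply, hrow]
    rw [e]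
    exact hLI'
  have hBdet : B.det ≠ 0 := det_ne_zero_of_linearIndependent_rows' B hBrows
  -- (vi) a complex node table off the zero set, and the Moore points `P_a = (Y_a^(2^c))_c`
  obtain ⟨Y, hY⟩ : ∃ Y : Fin h → ℂ, MvPolynomial.eval Y B.det ≠ 0 := by
    by_contra hall
    push Not at hall
    exact hBdet (MvPolynomial.funext fun Y => by rw [hall Y, map_zero])
  refine ⟨fun a c => Y a ^ 2 ^ (c : ℕ), ?_⟩
  rw [RingHom.map_det] at hY
  have hmat : (MvPolynomial.eval Y).mapMatrix B = Matrix.of fun i j : Fin (windowStart (h + 1)) =>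
      ∏ c ∈ benchCols h (windowStart (h + 1)) j, ∑ a ∈ u i, Y a ^ 2 ^ (c : ℕ) := by
    ext i j
    rw [RingHom.mapMatrix_apply, Matrix.map_apply, hB, Matrix.of_apply, Matrix.of_apply, map_prod]
    refine Finset.prod_congr rfl fun c _ => ?_
    rw [map_sum]
    refine Finset.sum_congr rfl fun a _ => ?_
    rw [map_pow, MvPolynomial.eval_X]
  rw [hmat] at hY
  exact hY

end Midpoint

/-- **THEOREM M (memo `HOME/val-np-p4/g25/MEMO-valnp4-g25.md` §4bis; reading of record R24 of line
`moore_peel`).**  For EVERY height `h`, the sumset configuration `{0} ∪ {P_a} ∪ {P_a + P_b}` of `h`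
generic points — already of generic points of the Moore curve `P_a = (Y_a^(2^c))_c` — is poised for the
first `c_{h+1} = 1 + h + C(h,2)` binary-code monomials.  Proof: the kernel-weighted hierarchical Moore
peel with unit weights (THEOREM A^1), whose stage matrices are the zeta windows, all unimodular by
LEMMA Z′ (`…ChowBenchmarkPairsZetaMinors`). -/
theorem midpointPoisedAt (h : ℕ) : MidpointPoisedAt h :=
  midpointPoisedAt_of_linearIndependent h (linearIndependent_krow_one_stageOne h)

/-- **THEOREM M, ∀h form**: `Stmt.midpointPoised` holds. -/
theorem midpointPoised : Stmt.midpointPoised := midpointPoisedAt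

/-- The midpoint entry is the factorial-free segment entry: `∏_{c∈T} Σ_{a∈S} P_{a,c} = Σ_{g : T → S} ∏_{c : T} P_{g c, c}`
(compare `segEntry` of the line file, which weights each `g` by `∏_{a∈S} |g⁻¹(a)|!`). -/
theorem prod_sum_eq_sum_functions {h : ℕ} (P : Fin h → Fin h → ℂ) (S T : Finset (Fin h)) :
    ∏ c ∈ T, ∑ a ∈ S, P a c = ∑ g : (↥T → ↥S), ∏ c : ↥T, P (g c) c := by
  classical
  rw [← Finset.prod_coe_sort T]
  simp_rw [← Finset.sum_coe_sort S]
  rw [Fintype.prod_sum]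

end Summit.ValiantsHypothesis.ValiantsHypothesis.Theorems.BarrierLever.MoorePeel
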